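import Summits.ValiantsHypothesis.ValiantsHypothesis.Theorems.NewtonUnitEquationsTwoProductsTowerRecordSweep
import Summits.ValiantsHypothesis.ValiantsHypothesis.Theorems.NewtonUnitEquationsTwoProductsTowerRecordLiftRecord
import Summits.ValiantsHypothesis.ValiantsHypothesis.Theorems.NewtonUnitEquationsTwoProductsTowerRecordCarrierLaw

/-!
# R13∞ — THE LEVEL-FREE CARRIER LAW, PROVED (class side of crit-8's Q-R13): every tower alphabet along one direction, tower-dissociated

(C2) The degree-`D` Lift (✓ `…TowerRecordLiftRecord :: Lift.card_cellFamily_le_records`, `E = [0, D]`) transfers val-idea-37 g4's LEVEL-FREE record law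
(✓ `…TowerRecordSweep :: levelFreeRecordLaw_holds`, (a,b) = (11,1): ARBITRARY pencils, bound free of height and level set — val-idea-crit-8 g2 VERDICT #20)
to the class side:
* ★ `levelFreeCarrier_of_levelFreeRecord_holds : levelFreeCarrier_of_levelFreeRecord` (the transfer, typed in ✓ `…TowerRecordCramer` §11b);
* ★★★ `levelFreeCarrierLaw_holds : LevelFreeCarrierLaw` — every normalised `t`-sparse instance of `m` factor pairs whose tail alphabet lies in a tower
  `X ⊔ (X+d) ⊔ … ⊔ (X+D•d)` of ANY height `D` (carriers `x : Fin n → ℕ²`, ONE shift `d ∈ ℤ²`), tower-dissociated to depth `(m, D)`, obeys the per-cell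
  law `#S ≤ 2^{11 m}(t+2)` for every `IsCellFamily` `S` — NO factor `(D+1)`, NO level-count dependence: R13∞ ⊋ R13 (`TowerCarrierLaw`, `(18,2)×(D+1)`)
  ⊋ R12 (`ShiftedCarrierLaw`);
* `levelFreeCarrierLaw_of_vertexWalk` (the same, displayed as the composition through `VertexWalkBound`), `towerCarrierLaw_of_levelFreeCarrierLaw`
  (a fortiori) and `sparseLevelCarrierLaw_of_levelFreeCarrierLaw` (every `ℓ`, a fortiori) — the earlier class rungs become corollaries with constants (11,1)
  (the compositions with `levelFreeCarrierLaw_holds` are second kernel routes to ✓ `towerCarrierLaw_holds` / `sparseLevelCarrierLaw_holds`; not restated: dedup).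
HONEST LABEL (crit-8 #19/#20, binding): «level-free» refers to the BOUND; the hypothesis still depends on `D` through the dissociation box
`TowerDissociated x d m D` (margin `D·d`) — PARALLEL towers along ONE direction `d` on TOWER-DISSOCIATED carriers.  A CLASS rung of the relation ladder,
INERT AS A HATCH (it does not feed `PlanarCellBound` off the class); NOT covered: the collinear digit towers of Disproof F10 / fibre lumping
(`(S,k) ↦ S•x + k•d` non-injective), ≥ 2 independent shift directions, non-dissociated carriers; `ResidualLawV24` ⟺ `PlanarCellBound`, the crux
`…Theses.NewtonUnitEquations.TwoProducts` (stmt-5906), V0/V1/V6, every `closes` binder and every summit statement UNMOVED; summit-progress accounting +0;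
VP ≠ VNP is NOT proved.
Credit: coefficient laws (R12 count, tower, sparse, Cramer, vertex walk) val-idea-37 g4; critic / text owner val-idea-crit-8 g2; transplant + Lift + compositions
val-lit-p3 g18 (Lift architecture val-lit-p3 g17).  Helper on `stmt-ValiantsHypothesis-5906` (`--supports`), closes nothing.  No instances, no notation,
no named facts. [folklore]
-/

set_option linter.dupNamespace false

noncomputable section

open Classical

namespace Summit.ValiantsHypothesis.ValiantsHypothesis.Theorems.NewtonUnitEquations.TwoProducts.TowerRecord
open scoped BigOperators
open MvPolynomial
open Summit.ValiantsHypothesis.ValiantsHypothesis.Theorems.NewtonUnitEquations.TwoProducts.FormalLogLinearisation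
open Summit.ValiantsHypothesis.ValiantsHypothesis.Theorems.NewtonUnitEquations.TwoProducts.PlanarCell
open Summit.ValiantsHypothesis.ValiantsHypothesis.Theorems.NewtonUnitEquations.TwoProducts.MomentRecord

variable {m n : ℕ}

/-- ★ **THE TRANSFER (A_free) ⇒ (B_free): `LevelFreeRecordLaw → LevelFreeCarrierLaw`**, same constants (typed target
`levelFreeCarrier_of_levelFreeRecord` of ✓ `…TowerRecordCramer` §11b): the degree-`D` Lift with `E = [0, D]`. [folklore] -/
theorem levelFreeCarrier_of_levelFreeRecord_holds : levelFreeCarrier_of_levelFreeRecord := by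
  classical
  rintro ⟨a, b, hlaw⟩
  refine ⟨a, b, fun m t n D u v x d _ht hu hv halph hdis R S hS => ?_⟩
  have hED : ∀ j ∈ Finset.range (D + 1), j ≤ D := fun j hj => Nat.le_of_lt_succ (Finset.mem_range.mp hj)
  obtain ⟨n', x', hn', -, -, hdu, hdv, hcard⟩ :=
    Lift.card_cellFamily_le_records hu hv (Lift.towerAlphabet_range_of_le halph) hED hdis R S hS
  exact hcard.trans (hlaw m n' t D _ _ x' d hdu hdv hn')

/-- The composition displayed through the vertex walk bound: `VertexWalkBound → LevelFreeCarrierLaw` (`(a, b) = (11, 1)`). [folklore] -/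
theorem levelFreeCarrierLaw_of_vertexWalk (hV : VertexWalkBound) : LevelFreeCarrierLaw :=
  levelFreeCarrier_of_levelFreeRecord_holds (levelFree_of_vertexWalk hV)

/-- ★★★ **THE LEVEL-FREE CARRIER LAW (R13∞), PROVED** — `(a, b) = (11, 1)`: tail alphabet in a tower `X ⊔ (X+d) ⊔ … ⊔ (X+D•d)` of ANY height,
tower-dissociated to depth `(m, D)` ⇒ per-cell law `#S ≤ 2^{11 m}(t+2)`, free of `D` and of the level set.  = val-idea-37 g4's kernel
`vertexWalkBound_holds` / `levelFreeRecordLaw_holds` (✓ `…TowerRecordSweep`) ∘ the degree-`D` Lift.  HONEST LABEL: a CLASS rung (parallel towers along one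
direction on tower-dissociated carriers; «level-free» is free in the bound, not in the geometry), INERT AS A HATCH; F10 fibre lumping, ≥ 2 shift directions,
non-dissociated carriers NOT covered; not `PlanarCellBound`, not the crux; VP ≠ VNP is NOT proved. [folklore] -/
theorem levelFreeCarrierLaw_holds : LevelFreeCarrierLaw :=
  levelFreeCarrierLaw_of_vertexWalk vertexWalkBound_holds

/-- A fortiori: the level-free carrier law implies the tower-carrier law (drop the factor `D + 1 ≥ 1`). [folklore] -/
theorem towerCarrierLaw_of_levelFreeCarrierLaw (h : LevelFreeCarrierLaw) : TowerCarrierLaw := by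
  obtain ⟨a, b, hlaw⟩ := h
  refine ⟨a, b, fun m t n D u v x d ht hu hv halph hdis R S hS => ?_⟩
  exact (hlaw m t n D u v x d ht hu hv halph hdis R S hS).trans (Nat.le_mul_of_pos_right _ (Nat.succ_pos D))

/-- A fortiori: the level-free carrier law implies the sparse-level carrier law for every `ℓ` (forget `E`). [folklore] -/
theorem sparseLevelCarrierLaw_of_levelFreeCarrierLaw (h : LevelFreeCarrierLaw) (ℓ : ℕ) : SparseLevelCarrierLaw ℓ := by
  obtain ⟨a, b, hlaw⟩ := h
  refine ⟨a, b, fun m t n D u v x d E _hEℓ hED ht hu hv halph hdis R S hS => ?_⟩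
  refine hlaw m t n D u v x d ht hu hv (fun e he => ?_) hdis R S hS
  obtain ⟨i, j, hj, hc⟩ := halph e he
  exact ⟨i, j, hED j hj, hc⟩

end Summit.ValiantsHypothesis.ValiantsHypothesis.Theorems.NewtonUnitEquations.TwoProducts.TowerRecord

end
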